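import Literature.NumberTheory.Automorphic.OrbitalIntegralFixedPointWeighted      -- ★ I-3 (F0P2-p01): `integral_conj_eq_smul_finsum_fixedBy`
import Literature.GroupTheory.CosetSpaceProdTop                                   -- ★ I-7a p843352: `finsum_mem_fixedBy_quotient_prod_top_eq`
import Literature.GroupTheory.CosetSpaceMulEquivCongr                             -- ★ I-7 p843403: `finsum_mem_fixedBy_quotient_congr_eq`
import Literature.NumberTheory.Rogawski1990.RankOneKappaVertexCoverCM            -- ★ I-7b (iii): `finite_fixedBy_quotient_of_isCompact_setOf_conj_mem`, the `E₂` currency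
import HarnessLib

/-!
# The unfolding of a localised orbital integral on `H_v = U(Φ₂)(L⁺_v) × U(Φ₁)(L⁺_v)` down to a ONE-PLACE fixed-point sum (road «R1LL-tree», brick I-7 «`H_v` transport»)

Topic `NumberTheory/Rogawski1990`; namespace `Literature.NumberTheory.Rogawski1990` (CM corollaries) and `Literature.GroupTheory` (§1 generic).  THEOREMS ONLY (no
definition, no instance, no notation, no named fact, no `sorry`); kernel lane.  Cell `pub/hodgecm-mathlib`, crux H413 = `stmt-HodgeConjecture-24833`, road «R1LL-tree»
(architect A-p16 (g27), RULINGS A-11, A-13, A-14 (e), A-15 (c)): this is the `H_v → one-place` reduction that F0P3-p01 (g13)'s `hD` composes with A-p13 (g31)'s one-place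
depth expansion (α) L2-B (`ε = 0`) ∕ B-p10 (g26)'s `K¹` twin (`ε = 1`).  HONEST LABEL: HC_CM is proved only modulo the 2 remaining named inputs (hLiu418, h413) until rung 0
closes; this file is topological-group bookkeeping and asserts nothing printed.

THE MATHEMATICS (Rogawski 1990 §4.9 p. 54; Laumon 1996 Lemma (5.3.2); Kottwitz 1986 §3).  `G × A` a product of topological groups with a right-invariant measure `ν`,
`K ≤ G` with `K × A` open of finite measure, `φ : G × A → E` supported in `K × A` and `Ad(K × A)`-invariant, `x = (γ, α)` with finitely many fixed points on
`(G × A) ⧸ (K × A)`.  Then (★ I-3) `∫ φ(h x h⁻¹) dν(h) = ν(K × A) · Σ_{q ∈ Fix_x} φ(q.out⁻¹ x q.out)`, (★ I-7a) the sum is `Σ_{p ∈ Fix_γ(G⧸K)} φ(p.out⁻¹ γ p.out, α)`, and (★ I-7)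
along any `e : G ≃* G′` with `e(K) = K′` it is `Σ_{p ∈ Fix_{eγ}(G′⧸K′)} φ(e⁻¹(p.out⁻¹ (eγ) p.out), α)`.  At `G := U(Φ₂)(L⁺_v)`, `A := U(Φ₁)(L⁺_v)`, `G′ := U(σ_w, (Φ₂)_w)(L_w)`,
`e := E₂` the one-place model, this is the display of RULING A-11 up to the one-place evaluation of the finite sum.

* §1 `Literature.GroupTheory.integral_conj_eq_smul_finsum_fixedBy_prod_congr` (generic; `hfin` version) and `…_of_isCompact` (`hfin` ⟸ compact `{h | h x h⁻¹ ∈ K × A}`).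
* §2 `Literature.NumberTheory.Rogawski1990.integral_conj_eq_smul_finsum_onePlace` (+ `_of_isCompact`) — the same on `H_v` with an abstract one-place model
  `E₂ : U(Φ₂)(L⁺_v) ≃ₜ* ↥U(σ_w,(Φ₂)_w)(L_w)` and `hK : g ∈ K ↔ E₂ g ∈ K′` (instantiate with ★ `exists_vertexCover`'s dictionaries).

## References
* [Rogawski1990] J. D. Rogawski, *Automorphic Representations of Unitary Groups in Three Variables* (1990), §4.9 p. 54.
* [Laumon1995] G. Laumon, *Cohomology of Drinfeld Modular Varieties* I (1996), Lemma (5.3.2) p. 136.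
* [Kottwitz1986] R. E. Kottwitz, *Base change for unit elements of Hecke algebras*, Compositio Math. 60 (1986), §3.
-/

set_option autoImplicit false

noncomputable section

open MeasureTheory Topology Set Function MulAction NumberField IsDedekindDomain
open scoped MatrixGroups

/-! ## §1 Generic: product group, right-invariant measure, transport along `e : G ≃* G′` -/

namespace Literature.GroupTheory

variable {G A G' : Type*} [Group G] [Group A] [Group G'] [TopologicalSpace G] [TopologicalSpace A]
  [IsTopologicalGroup G] [IsTopologicalGroup A] [MeasurableSpace (G × A)] [BorelSpace (G × A)]
  (ν : Measure (G × A)) [ν.IsMulRightInvariant]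
  {E : Type*} [NormedAddCommGroup E] [NormedSpace ℝ E] [CompleteSpace E]

/-- **UNFOLDING ON `G × A` DOWN TO `G′ ⧸ K′`**: for `K × A` open of finite measure, `φ` supported in `K × A` and `Ad(K × A)`-invariant, `x` with finitely many fixed points on
`(G × A) ⧸ (K × A)`, and `e : G ≃* G′` with `e(K) = K′`:
`∫ φ(h x h⁻¹) dν(h) = ν(K × A) · Σ_{p ∈ Fix_{e x.1}(G′ ⧸ K′)} φ(e⁻¹(p.out⁻¹ (e x.1) p.out), x.2)` (★ I-3, ★ I-7a, ★ I-7).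
[cite: Rogawski1990, §4.9 p. 54] [cite: Laumon1995, Lemma (5.3.2) p. 136] [cite: Kottwitz1986, §3] -/
theorem integral_conj_eq_smul_finsum_fixedBy_prod_congr (K : Subgroup G) (K' : Subgroup G') (e : G ≃* G') (hK : ∀ g : G, g ∈ K ↔ e g ∈ K')
    (hKo : IsOpen ((K.prod (⊤ : Subgroup A) : Subgroup (G × A)) : Set (G × A))) (hKν : ν ((K.prod (⊤ : Subgroup A) : Subgroup (G × A)) : Set (G × A)) ≠ ⊤)
    (x : G × A) (φ : G × A → E) (hφ : support φ ⊆ ((K.prod (⊤ : Subgroup A) : Subgroup (G × A)) : Set (G × A)))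
    (hφK : ∀ k ∈ K.prod (⊤ : Subgroup A), ∀ y : G × A, φ (k * y * k⁻¹) = φ y)
    (hfin : (fixedBy ((G × A) ⧸ K.prod (⊤ : Subgroup A)) x).Finite) :
    ∫ h, φ (h * x * h⁻¹) ∂ν =
      ν.real ((K.prod (⊤ : Subgroup A) : Subgroup (G × A)) : Set (G × A)) •
        ∑ᶠ p ∈ fixedBy (G' ⧸ K') (e x.1), φ (e.symm (p.out⁻¹ * e x.1 * p.out), x.2) := by
  -- ★ I-3 on `G × A`
  rw [Literature.NumberTheory.Automorphic.integral_conj_eq_smul_finsum_fixedBy x (K.prod (⊤ : Subgroup A)) ν hKo hKν φ hφ hφK hfin]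
  congr 1
  -- ★ I-7a: kill the `A` factor
  obtain ⟨γ, α⟩ := x
  rw [finsum_mem_fixedBy_quotient_prod_top_eq K φ hφK γ α]
  -- ★ I-7: transport along `e` with `φ′ := φ (e⁻¹ ·, α)`
  have hφ' : ∀ k' ∈ K', ∀ y : G', φ (e.symm (k' * y * k'⁻¹), α) = φ (e.symm y, α) := by
    intro k' hk' y
    have hk : e.symm k' ∈ K := (hK _).2 (by rw [e.apply_symm_apply]; exact hk')
    have h := hφK (e.symm k', 1) (Subgroup.mem_prod.2 ⟨hk, Subgroup.mem_top _⟩) (e.symm y, α)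
    rw [Prod.inv_mk, Prod.mk_mul_mk, Prod.mk_mul_mk, inv_one, one_mul, mul_one, ← map_mul, ← map_inv, ← map_mul] at h
    exact h
  have h := finsum_mem_fixedBy_quotient_congr_eq K K' e hK (fun y : G' => φ (e.symm y, α)) hφ' γ
  simp only [e.symm_apply_apply] at h
  exact h

/-- The same with `hfin` discharged from COMPACTNESS of `{h | h x h⁻¹ ∈ K × A}` (★ `finite_fixedBy_quotient_of_isCompact_setOf_conj_mem`; the currency of ★ F0P3-p01
`isCompact_setOf_conj_mem_of_mem_centralizer`). [cite: Rogawski1990, §4.9 p. 54] [cite: Laumon1995, Lemma (5.3.2) p. 136] -/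
theorem integral_conj_eq_smul_finsum_fixedBy_prod_congr_of_isCompact (K : Subgroup G) (K' : Subgroup G') (e : G ≃* G')
    (hK : ∀ g : G, g ∈ K ↔ e g ∈ K')
    (hKo : IsOpen ((K.prod (⊤ : Subgroup A) : Subgroup (G × A)) : Set (G × A))) (hKν : ν ((K.prod (⊤ : Subgroup A) : Subgroup (G × A)) : Set (G × A)) ≠ ⊤)
    (x : G × A) (φ : G × A → E) (hφ : support φ ⊆ ((K.prod (⊤ : Subgroup A) : Subgroup (G × A)) : Set (G × A)))
    (hφK : ∀ k ∈ K.prod (⊤ : Subgroup A), ∀ y : G × A, φ (k * y * k⁻¹) = φ y)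
    (hc : IsCompact {h : G × A | h * x * h⁻¹ ∈ ((K.prod (⊤ : Subgroup A) : Subgroup (G × A)) : Set (G × A))}) :
    ∫ h, φ (h * x * h⁻¹) ∂ν =
      ν.real ((K.prod (⊤ : Subgroup A) : Subgroup (G × A)) : Set (G × A)) •
        ∑ᶠ p ∈ fixedBy (G' ⧸ K') (e x.1), φ (e.symm (p.out⁻¹ * e x.1 * p.out), x.2) :=
  integral_conj_eq_smul_finsum_fixedBy_prod_congr ν K K' e hK hKo hKν x φ hφ hφK
    (finite_fixedBy_quotient_of_isCompact_setOf_conj_mem (G := G × A) _ hKo x hc)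

end Literature.GroupTheory

/-! ## §2 CM: `H_v = U(Φ₂)(L⁺_v) × U(Φ₁)(L⁺_v)` with an abstract one-place model `E₂` -/

namespace Literature.NumberTheory.Rogawski1990

open Literature.NumberTheory.Automorphic Literature.NumberTheory.Automorphic.UnitaryGroup Literature.NumberTheory.GaloisRepresentations

variable (L : Type) [Field L] [NumberField L] [IsCMField L] (v : HeightOneSpectrum (𝓞 ↥(maximalRealSubfield L)))
  (w : PlacesOver L v) (hw : IsCMField.complexConj L • w.1 = w.1)
  [MeasurableSpace (((cmDatum L 2 (Matrix.of fun i j : Fin 2 => if i.val + j.val + 1 = 2 then (1 : L) else 0)).Local v ×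
    (cmDatum L 1 (Matrix.of fun i j : Fin 1 => if i.val + j.val + 1 = 1 then (1 : L) else 0)).Local v))]
  [BorelSpace (((cmDatum L 2 (Matrix.of fun i j : Fin 2 => if i.val + j.val + 1 = 2 then (1 : L) else 0)).Local v ×
    (cmDatum L 1 (Matrix.of fun i j : Fin 1 => if i.val + j.val + 1 = 1 then (1 : L) else 0)).Local v))]
  (ν : Measure (((cmDatum L 2 (Matrix.of fun i j : Fin 2 => if i.val + j.val + 1 = 2 then (1 : L) else 0)).Local v ×
    (cmDatum L 1 (Matrix.of fun i j : Fin 1 => if i.val + j.val + 1 = 1 then (1 : L) else 0)).Local v)))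
  [ν.IsMulRightInvariant]
  {E : Type*} [NormedAddCommGroup E] [NormedSpace ℝ E] [CompleteSpace E]

/-- **THE `H_v → ONE-PLACE` UNFOLDING (RULING A-11 ∕ A-15 (c) head for `hD`).**  For a compact open `K ≤ U(Φ₂)(L⁺_v)`, a one-place model
`E₂ : U(Φ₂)(L⁺_v) ≃ₜ* ↥U` (`U = U(σ_w,(Φ₂)_w)(L_w)`) and `K′ ≤ ↥U` with `g ∈ K ↔ E₂ g ∈ K′` (★ `exists_vertexCover`'s dictionaries), `φ : H_v → E` supported in `K × U(Φ₁)_v`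
and `Ad(K × U(Φ₁)_v)`-invariant, and `x ∈ H_v` with finitely many fixed points on `H_v ⧸ (K × U(Φ₁)_v)`:
`∫ φ(y x y⁻¹) dν(y) = ν(K × U(Φ₁)_v) · Σ_{p ∈ Fix_{E₂ x.1}(↥U ⧸ K′)} φ(E₂⁻¹(p.out⁻¹ (E₂ x.1) p.out), x.2)`.
[cite: Rogawski1990, §4.9 p. 54] [cite: Laumon1995, Lemma (5.3.2) p. 136] [cite: Kottwitz1986, §3] -/
theorem integral_conj_eq_smul_finsum_onePlace
    (K : Subgroup ((cmDatum L 2 (Matrix.of fun i j : Fin 2 => if i.val + j.val + 1 = 2 then (1 : L) else 0)).Local v))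
    (K' : Subgroup ↥(unitaryGroupOfForm (galAdicCompletionMap (L := L) (IsCMField.complexConj L) hw)
      (placeForm (Matrix.of fun i j : Fin 2 => if i.val + j.val + 1 = 2 then (1 : L) else 0) w.1)))
    (E₂ : (cmDatum L 2 (Matrix.of fun i j : Fin 2 => if i.val + j.val + 1 = 2 then (1 : L) else 0)).Local v ≃ₜ*
      ↥(unitaryGroupOfForm (galAdicCompletionMap (L := L) (IsCMField.complexConj L) hw)
        (placeForm (Matrix.of fun i j : Fin 2 => if i.val + j.val + 1 = 2 then (1 : L) else 0) w.1)))
    (hK : ∀ g, g ∈ K ↔ E₂ g ∈ K')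
    (hKo : IsOpen ((K.prod (⊤ : Subgroup ((cmDatum L 1 (Matrix.of fun i j : Fin 1 => if i.val + j.val + 1 = 1 then (1 : L) else 0)).Local v)) :
      Subgroup (((cmDatum L 2 (Matrix.of fun i j : Fin 2 => if i.val + j.val + 1 = 2 then (1 : L) else 0)).Local v ×
        (cmDatum L 1 (Matrix.of fun i j : Fin 1 => if i.val + j.val + 1 = 1 then (1 : L) else 0)).Local v))) : Set (((cmDatum L 2 (Matrix.of fun i j : Fin 2 => if i.val + j.val + 1 = 2 then (1 : L) else 0)).Local v × (cmDatum L 1 (Matrix.of fun i j : Fin 1 => if i.val + j.val + 1 = 1 then (1 : L) else 0)).Local v))))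
    (hKν : ν ((K.prod (⊤ : Subgroup ((cmDatum L 1 (Matrix.of fun i j : Fin 1 => if i.val + j.val + 1 = 1 then (1 : L) else 0)).Local v)) :
      Subgroup (((cmDatum L 2 (Matrix.of fun i j : Fin 2 => if i.val + j.val + 1 = 2 then (1 : L) else 0)).Local v ×
        (cmDatum L 1 (Matrix.of fun i j : Fin 1 => if i.val + j.val + 1 = 1 then (1 : L) else 0)).Local v))) : Set (((cmDatum L 2 (Matrix.of fun i j : Fin 2 => if i.val + j.val + 1 = 2 then (1 : L) else 0)).Local v × (cmDatum L 1 (Matrix.of fun i j : Fin 1 => if i.val + j.val + 1 = 1 then (1 : L) else 0)).Local v))) ≠ ⊤)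
    (x : ((cmDatum L 2 (Matrix.of fun i j : Fin 2 => if i.val + j.val + 1 = 2 then (1 : L) else 0)).Local v ×
      (cmDatum L 1 (Matrix.of fun i j : Fin 1 => if i.val + j.val + 1 = 1 then (1 : L) else 0)).Local v))
    (φ : (((cmDatum L 2 (Matrix.of fun i j : Fin 2 => if i.val + j.val + 1 = 2 then (1 : L) else 0)).Local v ×
      (cmDatum L 1 (Matrix.of fun i j : Fin 1 => if i.val + j.val + 1 = 1 then (1 : L) else 0)).Local v)) → E)
    (hφ : support φ ⊆ ((K.prod (⊤ : Subgroup ((cmDatum L 1 (Matrix.of fun i j : Fin 1 => if i.val + j.val + 1 = 1 then (1 : L) else 0)).Local v)) :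
      Subgroup (((cmDatum L 2 (Matrix.of fun i j : Fin 2 => if i.val + j.val + 1 = 2 then (1 : L) else 0)).Local v ×
        (cmDatum L 1 (Matrix.of fun i j : Fin 1 => if i.val + j.val + 1 = 1 then (1 : L) else 0)).Local v))) : Set (((cmDatum L 2 (Matrix.of fun i j : Fin 2 => if i.val + j.val + 1 = 2 then (1 : L) else 0)).Local v × (cmDatum L 1 (Matrix.of fun i j : Fin 1 => if i.val + j.val + 1 = 1 then (1 : L) else 0)).Local v))))
    (hφK : ∀ k ∈ K.prod (⊤ : Subgroup ((cmDatum L 1 (Matrix.of fun i j : Fin 1 => if i.val + j.val + 1 = 1 then (1 : L) else 0)).Local v)),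
      ∀ y, φ (k * y * k⁻¹) = φ y)
    (hfin : (fixedBy ((((cmDatum L 2 (Matrix.of fun i j : Fin 2 => if i.val + j.val + 1 = 2 then (1 : L) else 0)).Local v ×
        (cmDatum L 1 (Matrix.of fun i j : Fin 1 => if i.val + j.val + 1 = 1 then (1 : L) else 0)).Local v)) ⧸
          K.prod (⊤ : Subgroup ((cmDatum L 1 (Matrix.of fun i j : Fin 1 => if i.val + j.val + 1 = 1 then (1 : L) else 0)).Local v))) x).Finite) :
    ∫ y, φ (y * x * y⁻¹) ∂ν =
      ν.real ((K.prod (⊤ : Subgroup ((cmDatum L 1 (Matrix.of fun i j : Fin 1 => if i.val + j.val + 1 = 1 then (1 : L) else 0)).Local v)) :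
        Subgroup (((cmDatum L 2 (Matrix.of fun i j : Fin 2 => if i.val + j.val + 1 = 2 then (1 : L) else 0)).Local v ×
          (cmDatum L 1 (Matrix.of fun i j : Fin 1 => if i.val + j.val + 1 = 1 then (1 : L) else 0)).Local v))) : Set (((cmDatum L 2 (Matrix.of fun i j : Fin 2 => if i.val + j.val + 1 = 2 then (1 : L) else 0)).Local v × (cmDatum L 1 (Matrix.of fun i j : Fin 1 => if i.val + j.val + 1 = 1 then (1 : L) else 0)).Local v))) •
        ∑ᶠ p ∈ fixedBy (↥(unitaryGroupOfForm (galAdicCompletionMap (L := L) (IsCMField.complexConj L) hw)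
            (placeForm (Matrix.of fun i j : Fin 2 => if i.val + j.val + 1 = 2 then (1 : L) else 0) w.1)) ⧸ K') (E₂ x.1),
          φ (E₂.symm (p.out⁻¹ * E₂ x.1 * p.out), x.2) :=
  Literature.GroupTheory.integral_conj_eq_smul_finsum_fixedBy_prod_congr ν K K' E₂.toMulEquiv hK hKo hKν x φ hφ hφK hfin

/-- The same with `hfin` discharged from compactness of `{h | h x h⁻¹ ∈ K × U(Φ₁)_v}` (★ F0P3-p01 `isCompact_setOf_conj_mem_of_mem_centralizer` supplies it on the elliptic
regular torus). [cite: Rogawski1990, §4.9 p. 54] [cite: Laumon1995, Lemma (5.3.2) p. 136] -/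
theorem integral_conj_eq_smul_finsum_onePlace_of_isCompact
    (K : Subgroup ((cmDatum L 2 (Matrix.of fun i j : Fin 2 => if i.val + j.val + 1 = 2 then (1 : L) else 0)).Local v))
    (K' : Subgroup ↥(unitaryGroupOfForm (galAdicCompletionMap (L := L) (IsCMField.complexConj L) hw)
      (placeForm (Matrix.of fun i j : Fin 2 => if i.val + j.val + 1 = 2 then (1 : L) else 0) w.1)))
    (E₂ : (cmDatum L 2 (Matrix.of fun i j : Fin 2 => if i.val + j.val + 1 = 2 then (1 : L) else 0)).Local v ≃ₜ*
      ↥(unitaryGroupOfForm (galAdicCompletionMap (L := L) (IsCMField.complexConj L) hw)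
        (placeForm (Matrix.of fun i j : Fin 2 => if i.val + j.val + 1 = 2 then (1 : L) else 0) w.1)))
    (hK : ∀ g, g ∈ K ↔ E₂ g ∈ K')
    (hKo : IsOpen ((K.prod (⊤ : Subgroup ((cmDatum L 1 (Matrix.of fun i j : Fin 1 => if i.val + j.val + 1 = 1 then (1 : L) else 0)).Local v)) :
      Subgroup (((cmDatum L 2 (Matrix.of fun i j : Fin 2 => if i.val + j.val + 1 = 2 then (1 : L) else 0)).Local v ×
        (cmDatum L 1 (Matrix.of fun i j : Fin 1 => if i.val + j.val + 1 = 1 then (1 : L) else 0)).Local v))) : Set (((cmDatum L 2 (Matrix.of fun i j : Fin 2 => if i.val + j.val + 1 = 2 then (1 : L) else 0)).Local v × (cmDatum L 1 (Matrix.of fun i j : Fin 1 => if i.val + j.val + 1 = 1 then (1 : L) else 0)).Local v))))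
    (hKν : ν ((K.prod (⊤ : Subgroup ((cmDatum L 1 (Matrix.of fun i j : Fin 1 => if i.val + j.val + 1 = 1 then (1 : L) else 0)).Local v)) :
      Subgroup (((cmDatum L 2 (Matrix.of fun i j : Fin 2 => if i.val + j.val + 1 = 2 then (1 : L) else 0)).Local v ×
        (cmDatum L 1 (Matrix.of fun i j : Fin 1 => if i.val + j.val + 1 = 1 then (1 : L) else 0)).Local v))) : Set (((cmDatum L 2 (Matrix.of fun i j : Fin 2 => if i.val + j.val + 1 = 2 then (1 : L) else 0)).Local v × (cmDatum L 1 (Matrix.of fun i j : Fin 1 => if i.val + j.val + 1 = 1 then (1 : L) else 0)).Local v))) ≠ ⊤)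
    (x : ((cmDatum L 2 (Matrix.of fun i j : Fin 2 => if i.val + j.val + 1 = 2 then (1 : L) else 0)).Local v ×
      (cmDatum L 1 (Matrix.of fun i j : Fin 1 => if i.val + j.val + 1 = 1 then (1 : L) else 0)).Local v))
    (φ : (((cmDatum L 2 (Matrix.of fun i j : Fin 2 => if i.val + j.val + 1 = 2 then (1 : L) else 0)).Local v ×
      (cmDatum L 1 (Matrix.of fun i j : Fin 1 => if i.val + j.val + 1 = 1 then (1 : L) else 0)).Local v)) → E)
    (hφ : support φ ⊆ ((K.prod (⊤ : Subgroup ((cmDatum L 1 (Matrix.of fun i j : Fin 1 => if i.val + j.val + 1 = 1 then (1 : L) else 0)).Local v)) :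
      Subgroup (((cmDatum L 2 (Matrix.of fun i j : Fin 2 => if i.val + j.val + 1 = 2 then (1 : L) else 0)).Local v ×
        (cmDatum L 1 (Matrix.of fun i j : Fin 1 => if i.val + j.val + 1 = 1 then (1 : L) else 0)).Local v))) : Set (((cmDatum L 2 (Matrix.of fun i j : Fin 2 => if i.val + j.val + 1 = 2 then (1 : L) else 0)).Local v × (cmDatum L 1 (Matrix.of fun i j : Fin 1 => if i.val + j.val + 1 = 1 then (1 : L) else 0)).Local v))))
    (hφK : ∀ k ∈ K.prod (⊤ : Subgroup ((cmDatum L 1 (Matrix.of fun i j : Fin 1 => if i.val + j.val + 1 = 1 then (1 : L) else 0)).Local v)),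
      ∀ y, φ (k * y * k⁻¹) = φ y)
    (hc : IsCompact {h : ((cmDatum L 2 (Matrix.of fun i j : Fin 2 => if i.val + j.val + 1 = 2 then (1 : L) else 0)).Local v ×
        (cmDatum L 1 (Matrix.of fun i j : Fin 1 => if i.val + j.val + 1 = 1 then (1 : L) else 0)).Local v) |
        h * x * h⁻¹ ∈ ((K.prod (⊤ : Subgroup ((cmDatum L 1 (Matrix.of fun i j : Fin 1 => if i.val + j.val + 1 = 1 then (1 : L) else 0)).Local v)) :
          Subgroup (((cmDatum L 2 (Matrix.of fun i j : Fin 2 => if i.val + j.val + 1 = 2 then (1 : L) else 0)).Local v ×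
            (cmDatum L 1 (Matrix.of fun i j : Fin 1 => if i.val + j.val + 1 = 1 then (1 : L) else 0)).Local v))) : Set (((cmDatum L 2 (Matrix.of fun i j : Fin 2 => if i.val + j.val + 1 = 2 then (1 : L) else 0)).Local v × (cmDatum L 1 (Matrix.of fun i j : Fin 1 => if i.val + j.val + 1 = 1 then (1 : L) else 0)).Local v)))}) :
    ∫ y, φ (y * x * y⁻¹) ∂ν =
      ν.real ((K.prod (⊤ : Subgroup ((cmDatum L 1 (Matrix.of fun i j : Fin 1 => if i.val + j.val + 1 = 1 then (1 : L) else 0)).Local v)) :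
        Subgroup (((cmDatum L 2 (Matrix.of fun i j : Fin 2 => if i.val + j.val + 1 = 2 then (1 : L) else 0)).Local v ×
          (cmDatum L 1 (Matrix.of fun i j : Fin 1 => if i.val + j.val + 1 = 1 then (1 : L) else 0)).Local v))) : Set (((cmDatum L 2 (Matrix.of fun i j : Fin 2 => if i.val + j.val + 1 = 2 then (1 : L) else 0)).Local v × (cmDatum L 1 (Matrix.of fun i j : Fin 1 => if i.val + j.val + 1 = 1 then (1 : L) else 0)).Local v))) •
        ∑ᶠ p ∈ fixedBy (↥(unitaryGroupOfForm (galAdicCompletionMap (L := L) (IsCMField.complexConj L) hw)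
            (placeForm (Matrix.of fun i j : Fin 2 => if i.val + j.val + 1 = 2 then (1 : L) else 0) w.1)) ⧸ K') (E₂ x.1),
          φ (E₂.symm (p.out⁻¹ * E₂ x.1 * p.out), x.2) :=
  Literature.GroupTheory.integral_conj_eq_smul_finsum_fixedBy_prod_congr_of_isCompact ν K K' E₂.toMulEquiv hK hKo hKν x φ hφ hφK hc

end Literature.NumberTheory.Rogawski1990

end
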